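import Summits.QuantumFields.BalabanUV.Beta.CombChartContactFactor
import Summits.QuantumFields.BalabanUV.Beta.LagrangeFoldSym
import Summits.QuantumFields.BalabanUV.Beta.SymBorderedHessianStepBlind

/-!
# `BalabanUV.Beta.LagrangeFoldLegged` — binder row D1, RULING R-D1-g35-1 (chart (III′)), brick P4c-W-iv (part 1 of 2): **THE LEGGED MIXED SANDWICHES THROUGH THE
# COMB-CHART RESOLVENT, AND THE COINCIDENCE OF THE LEGGED AND THE RAW Λ-COEFFICIENTS** (`lamCoeffK (Gsym Lc j) (E2 j) Lc = lamCoeffK (KInvStep Lc j) (E2 j) Lc`)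

HONEST FRAMING (cell contract, verbatim): «discharging `BetaPertH` makes Bałaban's UV stability UNCONDITIONAL — a real constructive-QFT
result; it is NOT the continuum limit and NOT the Clay problem.»  HONEST DEPENDENCY: continuum YM on T⁴ ⇐ BetaPertH ∧ nine spine estimates (0/9 proved);
BetaPertH ⇐ (D1) ∧ (D4) ∧ CAP+tail; G-an2-4 gates asym, D1 and NE2/3/4.
DERIVED cell leaf ([folklore] kernel bookkeeping BY NAME; β sub-cell, BINDER-OWNERS row D1 OWNER `b2b-balaban-beta-an2` gen 36).  No statement of Bałaban's papers,
no `[cite:]`, no `Prop` fact, no `def`.  Discharges NO binder by itself; RECORD = ROOT M′ p303989 (chart (II)) unchanged; NOT D1, NOT `BetaPertH`, NOT continuum, NOT Clay.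
WHY (owner's located finding X-an2-g36-2 on the socket (c1)′ of the chart-(III′) Ward half).  Chart (II)'s Λ-fold (`LagrangeFoldSym`) uses the STRAIGHT block facts
`(KInvStep ∘ bhKStep)_mf = 0`, `(bhKStep ∘ Gsym)_mm = 1_coarse`; through `G′ = Π_c Gsym Π_cᵀ = GcombSh` the straight border is not blind to the rooted comb dressing
(`CombChartSpreadBlind`), so that route is closed.  §1 THE LEGGED SANDWICH: `LagrangeFoldMixed.mm_mixed_sandwich_eq_neg` at `(A, M, G) := (Gsym, bhKStepSh d Lc (Dsh Lc), GcombSh)` —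
`(Gsym ∘ 𝕄′)_mf = 0` (`RelInvFactorSandwich.comp_Gsym_bhKStepSh_inr_inl`, (DG) a theorem for `Dsh Lc`) and `(𝕄′ ∘ G′)_mm = 1_coarse` (P2, `CombChartContactFactor.comp_bhKStepSh_GcombSh_inr_inr`):
**`colM (Gsym (j+1) ∘ E2 (j+1) ∘ GcombSh (j+1)) = −(wVH (j+1))⁻¹ · colM (GcombSh (j+1))`**, and level 0 with the field block of `bhK Lc`.  §2 the Λ-coefficient kernels — `E2 j` (bounded
CO-CLOSED rows, `BorderedHessian.codiff₁_wΦ_shift`, over `SymBorderedHessianStepBlind.tsum_mul_piKSymBm_inl_inl`) and the field block of `bhK Lc` (`SymBorderedHessianBlind.comp_piKSymBm_bhK`) —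
are LEFT-blind to `piKSymBm`; §3 the multiplier rows of `coDressKSymAt K` against a left-blind kernel are those of `K` (tame associativity), hence
**`lamCoeffK_Gsym_E2 : lamCoeffK (Gsym Lc j) (E2 d Lc j) Lc = lamCoeffK (KInvStep Lc j) (E2 d Lc j) Lc`** and its level-0 twin `lamCoeffK_Gsym_H0`.  Part 2 (`LagrangeFoldComb`) folds.
Provenance: β sub-cell, unit beta-an2 gen 36, 2026-08-22 (v2; v1 = §1 level `j+1` only, staged not filed); over `LagrangeFoldMixed`, `SymBorderedHessian(Step)Blind`, `BorderedHessian`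
(`ValueHessianBlind`), `SymmetrisedDressingKernel`, `RelInvFactorSandwich`, `CombChartContactFactor` BY NAME; no existing file touched.
-/

noncomputable section

open Finset
open scoped BigOperators
open Literature.Probability.LatticeModels (Torus.proj)
open Literature.MathematicalPhysics.QuantumFieldTheory
open Literature.MathematicalPhysics.QuantumFieldTheory.Balaban1983to89
open Literature.MathematicalPhysics.QuantumFieldTheory.Balaban1983to89.Beta
open ExpKernelCalculus (MKer Decays VertexFamily comp)
open KernelWard (bdd_of_decays bdd_of_biLoc)
open AffineAveraging (box toSite codiff₁)
open AveragingContoursRooted (ctr ctrOff ctrOff_mem_box)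
open OneStepResolventKernel (Fib KInv LocStencil decays_mono)
open OneStepKernelFamily (KInvStep decays_KInvStep colH vertexOfK)
open InterLevelTransport (SLam cwsum cwsum_apply)
open BalabanStepJets (lamCoeffOf)
open BalabanStepJetsSucc (lamCoeffK E2 wVH wΛ decays_E2 decays_comp)
open BalabanStepW2 (wM1)
open KernelSpecInstance (wΦ)
open SecondOrderResponse (colM vertexOfM dM)
open Summit.QuantumFields.BalabanUV.Beta.TameKernelCalculus
open Summit.QuantumFields.BalabanUV.Beta.AxialDressingRooted (one_le_of_neZero)
open Summit.QuantumFields.BalabanUV.Beta.BorderedHessian (bhK bhK_inr_inr bhKAt bhKAt_inl_inl decays_bhK bhKStep bhKStep_zero bhKStep_succ_inl_inl spr_bhKStep KInvStep_zero_eq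
  E2_inl_inl_eq_wΦ E2_inl_inr E2_inr exists_abs_wΦ_le codiff₁_wΦ_shift spr_KInvStep)
open Summit.QuantumFields.BalabanUV.Beta.ChartConjugationReflection (vertexOfK_add abs_le_of_locStencil)
open Summit.QuantumFields.BalabanUV.Beta.ChartConjugationRelative (spr_comp)
open Summit.QuantumFields.BalabanUV.Beta.LagrangeFold (vertexOfK_smul_SLam_lamCoeffK E2_inr_col)
open Summit.QuantumFields.BalabanUV.Beta.LagrangeFoldStep (wVH_ne_zero wΛ_eq_wM1_mul_wVH)
open Summit.QuantumFields.BalabanUV.Beta.LagrangeFoldZero (lamCoeffOf_eq_lamCoeffK wM1_zero)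
open Summit.QuantumFields.BalabanUV.Beta.LagrangeFoldMixed (mm_mixed_sandwich_eq_neg)
open Summit.QuantumFields.BalabanUV.Beta.SymmetrisedDressingKernel (piKSymBm piKSymBm_inl_inl piKSymBm_inl_inr piKSymBm_inr_inl piKSymBm_inr_inr coDressKSymAt coDressKSymAt_eq
  comp_piKSymBm_inr spr_piKSymBm spr_trK_piKSymBm)
open Summit.QuantumFields.BalabanUV.Beta.SymBorderedHessianBlind (comp_piKSymBm_bhK)
open Summit.QuantumFields.BalabanUV.Beta.SymBorderedHessianStepBlind (tsum_mul_piKSymBm_inl_inl)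
open Summit.QuantumFields.BalabanUV.Beta.SymmetrisedStepJets (Gsym Gsym_apply decays_Gsym SymTables)
open Summit.QuantumFields.BalabanUV.Beta.SymShiftedSpread (bhKStepSh bhKStepSh_apply spr_bhKStepSh)
open Summit.QuantumFields.BalabanUV.Beta.DshAn1 (Dsh Dsh_inl_inl Dsh_inr_inr spr_Dsh)
open Summit.QuantumFields.BalabanUV.Beta.RelInvFactorSandwich (Gsym_inr_col_coarse comp_Gsym_bhKStepSh_inr_inl spr_Gsym)
open Summit.QuantumFields.BalabanUV.Beta.E3ContactFactor (bhKStepSh_mm)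
open Summit.QuantumFields.BalabanUV.Beta.CombChartStepJets (GcombSh decays_GcombSh ScombOf SpureCombOf ScombOf_eq SpureCombOf_eq)
open Summit.QuantumFields.BalabanUV.Beta.CombChartContactFactor (comp_Gsym_Dsh_inr_inl comp_bhKStepSh_GcombSh_inr_inr GcombSh_inr_inr)
open Summit.QuantumFields.BalabanUV.Beta.SpineRooted (M1Of M1Of_apply SpureRecOf locStencil_SpureRecOf locStencil_SrecOf SrecOf_eq_SpureRecOf_add_lam_zero
  SrecOf_eq_SpureRecOf_add_lam_succ)
open Summit.QuantumFields.BalabanUV.Beta.WardLocusRecursive (SrecOf)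

namespace Summit.QuantumFields.BalabanUV.Beta.LagrangeFoldLegged

variable {d Lc : ℕ} [NeZero Lc]

/-! ## §1 The legged mixed sandwiches through the comb-chart resolvent -/

/-- [folklore] **THE LEGGED MIXED SANDWICH, LEVEL `j+1`**: `colM (Gsym Lc (j+1) ∘ E2 (j+1) ∘ GcombSh Lc (j+1)) = −(wVH (j+1))⁻¹ · colM (GcombSh Lc (j+1))`. -/
theorem colM_mixed_sandwich_E2_legged (j : ℕ) (μ : Fin (d + 1)) (y : Fin (d + 1) → ℤ) (ρ' : Fin (d + 1)) (w : Fin (d + 1) → ℤ) :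
    colM (comp (comp (Gsym (d := d) Lc (j + 1)) (E2 d Lc (j + 1))) (GcombSh (d := d) Lc (j + 1))) Lc μ y ρ' w
      = -(wVH d Lc (j + 1))⁻¹ * colM (GcombSh (d := d) Lc (j + 1)) Lc μ y ρ' w := by
  have hL : 1 ≤ Lc := one_le_of_neZero Lc
  set A := Gsym (d := d) Lc (j + 1) with hAdef
  set G := GcombSh (d := d) Lc (j + 1) with hGdef
  set H : MKer (d + 1) (Fib d) := fun x z a b => wVH d Lc (j + 1) * E2 d Lc (j + 1) x z a b with hH
  have hw : wVH d Lc (j + 1) ≠ 0 := wVH_ne_zero (j + 1)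
  obtain ⟨CM, δM, hδM, hMd⟩ := spr_bhKStepSh (d := d) (Lc := Lc) (spr_Dsh hL) (j + 1)
  have hkkt := mm_mixed_sandwich_eq_neg (N := Lc) (A := A) (M := bhKStepSh d Lc (Dsh Lc) (j + 1)) (G := G) (H := H)
    (decays_Gsym (d := d) Lc (j + 1)) (decays_GcombSh (d := d) Lc (j + 1))
    ⟨CM, fun x z a b => bdd_of_decays hMd hδM.le x z a b⟩ (fun x z ν ν' => bhKStepSh_mm (fun x' y' κ l => Dsh_inr_inr Lc x' y' κ l) (j + 1) x z ν ν')
    (fun x z κ l => by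
      rw [hH, bhKStepSh_apply]
      simp only [Pi.add_apply, Pi.smul_apply, smul_eq_mul, bhKStep_succ_inl_inl, Dsh_inl_inl, mul_zero, add_zero])
    (fun x z κ ν => by simp only [hH, E2_inr_col, mul_zero])
    (fun x z ν l => by simp only [hH]; exact mul_eq_zero_of_right _ rfl) (fun x z ν ν' => by simp only [hH, E2_inr_col, mul_zero])
    (fun x v m l => comp_Gsym_bhKStepSh_inr_inl (spr_Dsh hL) (j + 1) (comp_Gsym_Dsh_inr_inl (j + 1)) x v m l)
    (fun u z ν m' hu => comp_bhKStepSh_GcombSh_inr_inr (d := d) (Lc := Lc) (j + 1) u z ν m' hu)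
    (fun x u m ν hu => Gsym_inr_col_coarse (j + 1) x u (Sum.inr m) ν hu)
    ((Lc : ℤ) • w) ((Lc : ℤ) • y) ρ' μ
  have hlin : comp (comp A H) G ((Lc : ℤ) • w) ((Lc : ℤ) • y) (Sum.inr ρ') (Sum.inr μ)
      = wVH d Lc (j + 1) * comp (comp A (E2 d Lc (j + 1))) G ((Lc : ℤ) • w) ((Lc : ℤ) • y) (Sum.inr ρ') (Sum.inr μ) := by
    have hAH : comp A H = fun x z a b => wVH d Lc (j + 1) * comp A (E2 d Lc (j + 1)) x z a b := by
      funext x z a b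
      simp only [ExpKernelCalculus.comp, hH, ← tsum_mul_left, Finset.mul_sum]
      exact tsum_congr fun u => Finset.sum_congr rfl fun f _ => by ring
    rw [hAH]
    rw [show comp (fun x z a b => wVH d Lc (j + 1) * comp A (E2 d Lc (j + 1)) x z a b) G ((Lc : ℤ) • w) ((Lc : ℤ) • y) (Sum.inr ρ') (Sum.inr μ)
        = ∑' v, ∑ g : Fib d, (wVH d Lc (j + 1) * comp A (E2 d Lc (j + 1)) ((Lc : ℤ) • w) v (Sum.inr ρ') g) * G v ((Lc : ℤ) • y) g (Sum.inr μ)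
        from rfl,
      show comp (comp A (E2 d Lc (j + 1))) G ((Lc : ℤ) • w) ((Lc : ℤ) • y) (Sum.inr ρ') (Sum.inr μ)
        = ∑' v, ∑ g : Fib d, comp A (E2 d Lc (j + 1)) ((Lc : ℤ) • w) v (Sum.inr ρ') g * G v ((Lc : ℤ) • y) g (Sum.inr μ) from rfl,
      ← tsum_mul_left]
    exact tsum_congr fun v => by rw [Finset.mul_sum]; exact Finset.sum_congr rfl fun g _ => by ring
  have hGmm : G ((Lc : ℤ) • w) ((Lc : ℤ) • y) (Sum.inr ρ') (Sum.inr μ) = A ((Lc : ℤ) • w) ((Lc : ℤ) • y) (Sum.inr ρ') (Sum.inr μ) := by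
    rw [hGdef, hAdef]; exact GcombSh_inr_inr (j + 1) _ _ _ _
  simp only [colM]
  rw [hGmm]
  rw [hlin] at hkkt
  field_simp
  linarith

/-- [folklore] **THE LEGGED MIXED SANDWICH, LEVEL `0`**, for any kernel `H₀` whose only block is the field block of `bhK Lc`:
`colM (Gsym Lc 0 ∘ H₀ ∘ GcombSh Lc 0) Lc μ y ρ′ w = −colM (GcombSh Lc 0) Lc μ y ρ′ w` (`𝕄′_0 = bhK + stepScale 0 • Dsh` has the same field block). -/
theorem colM_mixed_sandwich_zero_legged {H₀ : MKer (d + 1) (Fib d)}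
    (hHff : ∀ x z (κ l : Fin (d + 1)), H₀ x z (Sum.inl κ) (Sum.inl l) = bhK (d := d) Lc x z (Sum.inl κ) (Sum.inl l))
    (hHfm : ∀ x z (κ ν : Fin (d + 1)), H₀ x z (Sum.inl κ) (Sum.inr ν) = 0) (hHmf : ∀ x z (ν l : Fin (d + 1)), H₀ x z (Sum.inr ν) (Sum.inl l) = 0)
    (hHmm : ∀ x z (ν ν' : Fin (d + 1)), H₀ x z (Sum.inr ν) (Sum.inr ν') = 0)
    (μ : Fin (d + 1)) (y : Fin (d + 1) → ℤ) (ρ' : Fin (d + 1)) (w : Fin (d + 1) → ℤ) :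
    colM (comp (comp (Gsym (d := d) Lc 0) H₀) (GcombSh (d := d) Lc 0)) Lc μ y ρ' w = -colM (GcombSh (d := d) Lc 0) Lc μ y ρ' w := by
  have hL : 1 ≤ Lc := one_le_of_neZero Lc
  obtain ⟨CM, δM, hδM, hMd⟩ := spr_bhKStepSh (d := d) (Lc := Lc) (spr_Dsh hL) 0
  have hHff' : ∀ x z (κ l : Fin (d + 1)), H₀ x z (Sum.inl κ) (Sum.inl l) = bhKStepSh d Lc (Dsh Lc) 0 x z (Sum.inl κ) (Sum.inl l) := fun x z κ l => by
    rw [bhKStepSh_apply]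
    simp only [Pi.add_apply, Pi.smul_apply, smul_eq_mul, bhKStep_zero, Dsh_inl_inl, mul_zero, add_zero]
    exact hHff x z κ l
  have hkkt := mm_mixed_sandwich_eq_neg (N := Lc) (A := Gsym (d := d) Lc 0) (M := bhKStepSh d Lc (Dsh Lc) 0) (G := GcombSh (d := d) Lc 0) (H := H₀)
    (decays_Gsym (d := d) Lc 0) (decays_GcombSh (d := d) Lc 0) ⟨CM, fun x z a b => bdd_of_decays hMd hδM.le x z a b⟩
    (fun x z ν ν' => bhKStepSh_mm (fun x' y' κ l => Dsh_inr_inr Lc x' y' κ l) 0 x z ν ν')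
    hHff' hHfm hHmf hHmm (fun x v m l => comp_Gsym_bhKStepSh_inr_inl (spr_Dsh hL) 0 (comp_Gsym_Dsh_inr_inl 0) x v m l)
    (fun u z ν m' hu => comp_bhKStepSh_GcombSh_inr_inr (d := d) (Lc := Lc) 0 u z ν m' hu)
    (fun x u m ν hu => Gsym_inr_col_coarse 0 x u (Sum.inr m) ν hu)
    ((Lc : ℤ) • w) ((Lc : ℤ) • y) ρ' μ
  simp only [colM]
  rw [GcombSh_inr_inr 0]
  exact hkkt

/-! ## §2 The Λ-coefficient kernels are LEFT-blind to the symmetrised dressing -/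

/-- [folklore] **LEFT BLINDNESS OF THE VALUE HESSIAN TO THE SYMMETRISED BLOCK-MEAN DRESSING**: `comp (piKSymBm (toSite r) Lc) (E2 d Lc j) = E2 d Lc j` (every `j`, in-block root;
the twin of `BorderedHessian.comp_piKBm_E2` over `SymBorderedHessianStepBlind.tsum_mul_piKSymBm_inl_inl` — a bounded co-closed row is reproduced by the field block of `Π̂_sym`). -/
theorem comp_piKSymBm_E2 {r : Fin (d + 1) → ℕ} (hr : r ∈ box (d + 1) Lc) (j : ℕ) :
    comp (piKSymBm (toSite r) Lc) (E2 d Lc j) = E2 d Lc j := by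
  have hLc : 1 ≤ Lc := one_le_of_neZero Lc
  obtain ⟨C, hC⟩ := exists_abs_wΦ_le (N := Lc ^ j) (d := d)
  funext x z a b
  unfold ExpKernelCalculus.comp
  rcases a with α | m
  · rcases b with β | m'
    · have e : ∀ y, ∑ f : Fib d, piKSymBm (toSite r) Lc x y (Sum.inl α) f * E2 d Lc j y z f (Sum.inl β) =
          ∑ l, (fun l y => wΦ (N := Lc ^ j) l β (y - z)) l y * piKSymBm (toSite r) Lc x y (Sum.inl α) (Sum.inl l) := by
        intro y
        rw [Fintype.sum_sum_type]
        simp only [piKSymBm_inl_inr, zero_mul, Finset.sum_const_zero, add_zero, E2_inl_inl_eq_wΦ]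
        exact Finset.sum_congr rfl fun l _ => mul_comm _ _
      rw [tsum_congr e, tsum_mul_piKSymBm_inl_inl hLc hr (A := fun l y => wΦ (N := Lc ^ j) l β (y - z))
        (fun l y => hC l β (y - z)) (codiff₁_wΦ_shift β z) x α, E2_inl_inl_eq_wΦ]
    · have e : ∀ y, ∑ f : Fib d, piKSymBm (toSite r) Lc x y (Sum.inl α) f * E2 d Lc j y z f (Sum.inr m') = 0 := by
        intro y
        rw [Fintype.sum_sum_type]
        simp only [piKSymBm_inl_inr, zero_mul, Finset.sum_const_zero, add_zero, E2_inl_inr, mul_zero]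
      rw [tsum_congr e, tsum_zero, E2_inl_inr]
  · have e : ∀ y, ∑ f : Fib d, piKSymBm (toSite r) Lc x y (Sum.inr m) f * E2 d Lc j y z f b = 0 := by
      intro y
      rw [Fintype.sum_sum_type]
      simp only [piKSymBm_inr_inl, zero_mul, Finset.sum_const_zero, zero_add, E2_inr, mul_zero]
    rw [tsum_congr e, tsum_zero, E2_inr]

/-- [folklore] **LEFT BLINDNESS OF THE FIELD BLOCK OF `bhK Lc`**: for any `H₀` whose only block is the field block of `bhK Lc`, `comp (piKSymBm (toSite r) Lc) H₀ = H₀`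
(the `(f,f)` block of `SymBorderedHessianBlind.comp_piKSymBm_bhK`; the mixed blocks of `piKSymBm` vanish). -/
theorem comp_piKSymBm_H0 {r : Fin (d + 1) → ℕ} (hr : r ∈ box (d + 1) Lc) {H₀ : MKer (d + 1) (Fib d)}
    (hHff : ∀ x z (κ l : Fin (d + 1)), H₀ x z (Sum.inl κ) (Sum.inl l) = bhK (d := d) Lc x z (Sum.inl κ) (Sum.inl l))
    (hHfm : ∀ x z (κ ν : Fin (d + 1)), H₀ x z (Sum.inl κ) (Sum.inr ν) = 0) (hHm : ∀ x z (ν : Fin (d + 1)) (b : Fib d), H₀ x z (Sum.inr ν) b = 0) :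
    comp (piKSymBm (toSite r) Lc) H₀ = H₀ := by
  have hbl := comp_piKSymBm_bhK (d := d) (N := Lc) hr
  funext x z a b
  rcases a with α | m
  · rcases b with β | m'
    · have h1 := congrFun (congrFun (congrFun (congrFun hbl x) z) (Sum.inl α)) (Sum.inl β)
      unfold ExpKernelCalculus.comp at h1 ⊢
      have e : ∀ y, ∑ f : Fib d, piKSymBm (toSite r) Lc x y (Sum.inl α) f * H₀ y z f (Sum.inl β) =
          ∑ f : Fib d, piKSymBm (toSite r) Lc x y (Sum.inl α) f * bhK (d := d) Lc y z f (Sum.inl β) := by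
        intro y
        rw [Fintype.sum_sum_type, Fintype.sum_sum_type]
        simp only [piKSymBm_inl_inr, zero_mul, Finset.sum_const_zero, add_zero, hHff]
      rw [tsum_congr e, h1, hHff]
    · have e : ∀ y, ∑ f : Fib d, piKSymBm (toSite r) Lc x y (Sum.inl α) f * H₀ y z f (Sum.inr m') = 0 := by
        intro y
        rw [Fintype.sum_sum_type]
        simp only [piKSymBm_inl_inr, zero_mul, Finset.sum_const_zero, add_zero, hHfm, mul_zero]
      unfold ExpKernelCalculus.comp
      rw [tsum_congr e, tsum_zero, hHfm]
  · have e : ∀ y, ∑ f : Fib d, piKSymBm (toSite r) Lc x y (Sum.inr m) f * H₀ y z f b = 0 := by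
      intro y
      rw [Fintype.sum_sum_type]
      simp only [piKSymBm_inr_inl, zero_mul, Finset.sum_const_zero, zero_add, hHm, mul_zero]
    unfold ExpKernelCalculus.comp
    rw [tsum_congr e, tsum_zero, hHm]

/-! ## §3 The multiplier rows of `Gsym j ∘ X` are those of `KInvStep j ∘ X` for left-blind `X`; the Λ-coefficients coincide -/

/-- [folklore] **MULTIPLIER ROWS OF A SYMMETRISED CO-DRESSING AGAINST A LEFT-BLIND KERNEL**: if `comp (piKSymBm (toSite r) N) X = X` then
`comp (coDressKSymAt (toSite r) N K) X x z (inr m) b = comp K X x z (inr m) b` (tame associativity; the multiplier rows of `trK Π̂ ∘ K` are those of `K`). -/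
theorem comp_coDressKSymAt_inr_row {N : ℕ} (hN : 1 ≤ N) {r : Fin (d + 1) → ℕ} (hr : r ∈ box (d + 1) N) {K X : MKer (d + 1) (Fib d)}
    (hK : Spr K) (hX : Spr X) (hbl : comp (piKSymBm (toSite r) N) X = X) (x z : Fin (d + 1) → ℤ) (m : Fin (d + 1)) (b : Fib d) :
    comp (coDressKSymAt (toSite r) N K) X x z (Sum.inr m) b = comp K X x z (Sum.inr m) b := by
  have hT : Spr (comp (trK (piKSymBm (toSite r) N)) K) := spr_comp (spr_trK_piKSymBm hN hr) hK
  rw [coDressKSymAt_eq, ← comp_assoc_tame hT.tame (spr_piKSymBm hN hr).tame hX.tame, hbl]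
  have hrow : ∀ (y : Fin (d + 1) → ℤ) (c : Fib d), comp (trK (piKSymBm (toSite r) N)) K x y (Sum.inr m) c = K x y (Sum.inr m) c := by
    intro y c
    rw [show comp (trK (piKSymBm (toSite r) N)) K = trK (comp (trK K) (piKSymBm (toSite r) N)) by rw [trK_comp, trK_trK], trK_apply,
      comp_piKSymBm_inr, trK_apply]
  show (∑' y, ∑ c : Fib d, comp (trK (piKSymBm (toSite r) N)) K x y (Sum.inr m) c * X y z c b) = ∑' y, ∑ c : Fib d, K x y (Sum.inr m) c * X y z c b
  exact tsum_congr fun y => Finset.sum_congr rfl fun c _ => by rw [hrow]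

/-- [folklore] **THE LEGGED AND THE RAW Λ-COEFFICIENTS COINCIDE, EVERY LEVEL**: `lamCoeffK (Gsym Lc j) (E2 d Lc j) Lc = lamCoeffK (KInvStep Lc j) (E2 d Lc j) Lc`. -/
theorem lamCoeffK_Gsym_E2 (j : ℕ) : lamCoeffK (Gsym (d := d) Lc j) (E2 d Lc j) Lc = lamCoeffK (KInvStep (d := d) Lc j) (E2 d Lc j) Lc := by
  have hL : 1 ≤ Lc := one_le_of_neZero Lc
  have hE : Spr (E2 d Lc j) := by
    obtain ⟨δ, C, hδ, _, h⟩ := decays_E2 (d := d) (Lc := Lc) j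
    exact ⟨C, δ, hδ, h⟩
  funext μ y κ' u
  unfold lamCoeffK
  rw [Gsym_apply]
  exact comp_coDressKSymAt_inr_row hL (ctrOff_mem_box hL) (spr_KInvStep (d := d) (Lc := Lc) j) hE (comp_piKSymBm_E2 (ctrOff_mem_box hL) j) _ _ _ _

/-- [folklore] **LEVEL `0`**: for any `H₀` whose only block is the field block of `bhK Lc`, `lamCoeffK (Gsym Lc 0) H₀ Lc = lamCoeffK (KInvStep Lc 0) H₀ Lc`. -/
theorem lamCoeffK_Gsym_H0 {H₀ : MKer (d + 1) (Fib d)} (hH : Spr H₀)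
    (hHff : ∀ x z (κ l : Fin (d + 1)), H₀ x z (Sum.inl κ) (Sum.inl l) = bhK (d := d) Lc x z (Sum.inl κ) (Sum.inl l))
    (hHfm : ∀ x z (κ ν : Fin (d + 1)), H₀ x z (Sum.inl κ) (Sum.inr ν) = 0) (hHm : ∀ x z (ν : Fin (d + 1)) (b : Fib d), H₀ x z (Sum.inr ν) b = 0) :
    lamCoeffK (Gsym (d := d) Lc 0) H₀ Lc = lamCoeffK (KInvStep (d := d) Lc 0) H₀ Lc := by
  have hL : 1 ≤ Lc := one_le_of_neZero Lc
  funext μ y κ' u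
  unfold lamCoeffK
  rw [Gsym_apply]
  exact comp_coDressKSymAt_inr_row hL (ctrOff_mem_box hL) (spr_KInvStep (d := d) (Lc := Lc) 0) hH (comp_piKSymBm_H0 (ctrOff_mem_box hL) hHff hHfm hHm) _ _ _ _

end Summit.QuantumFields.BalabanUV.Beta.LagrangeFoldLegged

end
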